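import Literature.NumberTheory.PAdicHodge.CyclotomicTilt
import HarnessLib

/-!
# The kernel of the untilt `♯ : 𝒪_{ℂ_F}♭ → 𝒪_{ℂ_F}` is `ε^{ℤ_p}`

Topic `Literature/NumberTheory/PAdicHodge`; THEOREMS ONLY (no definition, no named fact, no instance, no `sorry`). Sequel of `CyclotomicTilt`
(Fontaine's `ε = (ζ_{pⁿ})_n ∈ 𝒪_{ℂ_F}♭`, `epsPow a = ε^a`, `untilt_epsPow : (ε^a)♯ = 1`). The CONVERSE:

* ★★ `PreTilt.exists_eq_epsPow_of_untilt_eq_one` — **if `x ∈ 𝒪_{ℂ_F}♭` has `x♯ = 1` then `x = ε^a` for some `a ∈ ℤ_p`.** Proof: the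
  `p^n`-th root `x_n = φ^{-n} x` has `(x_n♯)^{pⁿ} = x♯ = 1` (Mathlib `PreTilt.untilt_iterate_frobeniusEquiv_symm_pow`), so `x_n♯ = ζ_{pⁿ}^{k_n}`
  (`ζ_{pⁿ} = epsC p n` is a primitive `pⁿ`-th root of unity in the field `ℂ_F`, Mathlib `IsPrimitiveRoot.eq_pow_of_pow_eq_one`); `(x_{n+1}♯)^p = x_n♯`
  gives `k_{n+1} ≡ k_n (mod pⁿ)`, so `a = lim k_n ∈ ℤ_p` (Mathlib `PadicInt.toZModPow_ofIntSeq_of_pow_dvd_sub`); finally the `n`-th coefficient of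
  `x` is `x_n♯ mod p = ζ_{pⁿ}^{k_n} mod p`, which is the `n`-th coefficient of `ε^a` (`Perfection.ext`).
* `PreTilt.exists_pow_eq_epsPow_of_untilt_pow_eq_one` — if `(x♯)^{p^N} = 1` then `x^{p^N} = ε^a`;
  `PreTilt.exists_eq_epsPow_mul_of_untilt_eq` — if `x♯ = y♯` with `y` a unit of `𝒪_{ℂ_F}♭` then `x = ε^a · y`.

Use (line `kato_lever` of crux K★ `stmt-BirchSwinnertonDyer-22226`, the LEAD's (H4) step (2) `X₂ ∩ ℂ_F(1) = ℚ_p(1)` for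
`X₂ = ℚ_p · log[1+𝔪♭] ⊂ B_dR⁺/Fil²`): with `θ(log[x]) = log(x♯)` and `CompletedAlgClosurePadicNorm` (`log(x♯) = 0 ⇒ (x♯)^{p^N} = 1`),
`log[x] ∈ Fil¹ ⇒ x^{p^N} = ε^a ⇒ p^N log[x] = a · t`, i.e. `log[x] ∈ ℚ_p · t`. Infrastructure; BSD / K★ / [REC] are NOT proved by any of this.

## References
* J.-M. Fontaine, *Le corps des périodes p-adiques*, Astérisque 223 (1994), Exp. II §1.2.2–1.2.3 (`R = lim 𝒪_C`, `x ↦ x^{(0)}`, `ε`).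
  [FontaineAsterisque223III]
* J.-M. Fontaine, Y. Ouyang, *Theory of p-adic Galois representations*, §4.3 (the tilt and `♯`). [FontaineOuyang2022]
* P. Scholze, J. Weinstein, *Berkeley Lectures on p-adic Geometry* (2020), Lecture 2 (tilting). [ScholzeWeinstein2020]
-/

noncomputable section

open ValuativeRel Field Ideal UniformSpace

namespace Literature.NumberTheory.PAdicHodge

open Literature.NumberTheory.GaloisRepresentations
open Literature.NumberTheory.GaloisRepresentations.IsNonarchimedeanLocalField

variable {F : Type} [Field F] [ValuativeRel F] [TopologicalSpace F] [IsNonarchimedeanLocalField F]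
  [CharZero F] {p : ℕ} [hprime : Fact p.Prime] [Fact (¬ IsUnit (p : integerC F))]
  [IsAdicComplete (Ideal.span {(p : integerC F)}) (integerC F)]

omit [Fact (¬ IsUnit (p : integerC F))] [IsAdicComplete (Ideal.span {(p : integerC F)}) (integerC F)] in
/-- `ζ_{pⁿ} = epsC p n` is a primitive `pⁿ`-th root of unity in `ℂ_F` (it is one in `F̄`, and `F̄ → ℂ_F` is injective).
[cite: FontaineOuyang2022, §4.3] -/
theorem isPrimitiveRoot_coe_epsC (n : ℕ) : IsPrimitiveRoot ((epsC p n : integerC F) : CompletedAlgClosure F) (p ^ n) :=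
  (isPrimitiveRoot_epsRaw (F := F) (p := p) n).map_of_injective
    (f := (Completion.coeRingHom : NormedAlgClosure F →+* CompletedAlgClosure F))
    (Completion.coeRingHom : NormedAlgClosure F →+* CompletedAlgClosure F).injective

omit [Fact (¬ IsUnit (p : integerC F))] [IsAdicComplete (Ideal.span {(p : integerC F)}) (integerC F)] in
/-- A `pⁿ`-th root of unity in `𝒪_{ℂ_F}` is a power `ζ_{pⁿ}^k`, `k < pⁿ`. [cite: FontaineOuyang2022, §4.3] -/
theorem exists_eq_epsC_pow_of_pow_eq_one (n : ℕ) {u : integerC F} (hu : u ^ p ^ n = 1) :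
    ∃ k : ℕ, k < p ^ n ∧ u = epsC p n ^ k := by
  haveI : NeZero (p ^ n) := ⟨pow_ne_zero _ hprime.out.ne_zero⟩
  have hu' : ((u : integerC F) : CompletedAlgClosure F) ^ p ^ n = 1 := by
    rw [← SubmonoidClass.coe_pow, hu]; rfl
  obtain ⟨k, hk, hku⟩ := (isPrimitiveRoot_coe_epsC (F := F) (p := p) n).eq_pow_of_pow_eq_one hu'
  exact ⟨k, hk, Subtype.ext (by rw [SubmonoidClass.coe_pow]; exact hku.symm)⟩

/-- ★★ **The kernel of `♯` on `𝒪_{ℂ_F}♭` is `ε^{ℤ_p}`**: if `x♯ = 1` then `x = ε^a` for some `a ∈ ℤ_p` (`x = (x^{(n)})_n` with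
`x^{(0)} = 1` forces `x^{(n)} = ζ_{pⁿ}^{a mod pⁿ}`). [cite: FontaineAsterisque223III, Exp. II §1.2.2–1.2.3] [cite: FontaineOuyang2022, §4.3] -/
theorem PreTilt.exists_eq_epsPow_of_untilt_eq_one (x : PreTilt (integerC F) p) (hx : PreTilt.untilt x = 1) :
    ∃ a : ℤ_[p], x = epsPow a := by
  -- the `pⁿ`-th roots `x_n = φ^{-n} x` and their untilts `u_n`
  set xs : ℕ → PreTilt (integerC F) p := fun n => ((frobeniusEquiv (PreTilt (integerC F) p) p).symm^[n]) x with hxs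
  have hxs_succ : ∀ n, xs (n + 1) ^ p = xs n := fun n => by
    simp only [hxs, Function.iterate_succ_apply']
    exact frobeniusEquiv_symm_pow_p _ p _
  set u : ℕ → integerC F := fun n => PreTilt.untilt (xs n) with hudef
  have hu_pow : ∀ n, u n ^ p ^ n = 1 := fun n => by
    simp only [hudef, hxs]
    rw [PreTilt.untilt_iterate_frobeniusEquiv_symm_pow, hx]
  have hu_succ : ∀ n, u (n + 1) ^ p = u n := fun n => by
    simp only [hudef]
    rw [← map_pow, hxs_succ]
  have hu_coeff : ∀ n, Ideal.Quotient.mk _ (u n) = PreTilt.coeff n x := fun n => by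
    simp only [hudef]
    rw [PreTilt.mk_untilt_eq_coeff_zero, hxs, PreTilt.coeff_iterate_frobeniusEquiv_symm, zero_add]
  -- exponents `k_n < pⁿ` with `u_n = ζ_{pⁿ}^{k_n}`
  have hk : ∀ n, ∃ k : ℕ, k < p ^ n ∧ u n = epsC p n ^ k := fun n => exists_eq_epsC_pow_of_pow_eq_one n (hu_pow n)
  choose k hk_lt hk_eq using hk
  -- compatibility `k_{n+1} ≡ k_n (mod pⁿ)`
  have hk_mod : ∀ n, k (n + 1) % p ^ n = k n := fun n => by
    have h1 : (epsC p n : integerC F) ^ k (n + 1) = epsC p n ^ k n := by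
      rw [← hk_eq n, ← hu_succ n, hk_eq (n + 1), ← pow_mul, mul_comm, pow_mul, epsC_succ_pow]
    rw [pow_eq_pow_mod_of_pow_eq_one (epsC_pow n) (k (n + 1))] at h1
    have h2 : ((epsC p n : integerC F) : CompletedAlgClosure F) ^ (k (n + 1) % p ^ n) =
        ((epsC p n : integerC F) : CompletedAlgClosure F) ^ k n := by
      rw [← SubmonoidClass.coe_pow, ← SubmonoidClass.coe_pow, h1]
    exact (isPrimitiveRoot_coe_epsC (F := F) (p := p) n).pow_inj (Nat.mod_lt _ (pow_pos hprime.out.pos n)) (hk_lt n) h2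
  -- the `p`-adic integer `a = lim k_n`
  have hdvd : ∀ i, (p : ℤ) ^ i ∣ ((k (i + 1) : ℕ) : ℤ) - ((k i : ℕ) : ℤ) := fun i => by
    refine ⟨((k (i + 1) / p ^ i : ℕ) : ℤ), ?_⟩
    have h := Nat.div_add_mod (k (i + 1)) (p ^ i)
    rw [hk_mod i] at h
    have h' : ((k (i + 1) : ℕ) : ℤ) = (p : ℤ) ^ i * ((k (i + 1) / p ^ i : ℕ) : ℤ) + ((k i : ℕ) : ℤ) := by
      exact_mod_cast h.symm
    rw [h']; ring
  set a : ℤ_[p] := PadicInt.ofIntSeq _ (PadicInt.isCauSeq_padicNorm_of_pow_dvd_sub (fun n => ((k n : ℕ) : ℤ)) p hdvd) with ha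
  have ha_val : ∀ n, (PadicInt.toZModPow n a).val = k n := fun n => by
    haveI : NeZero (p ^ n) := ⟨pow_ne_zero _ hprime.out.ne_zero⟩
    have h := PadicInt.toZModPow_ofIntSeq_of_pow_dvd_sub (fun n => ((k n : ℕ) : ℤ)) p hdvd n
    rw [← ha] at h
    rw [h, Int.cast_natCast, ZMod.val_natCast, Nat.mod_eq_of_lt (hk_lt n)]
  refine ⟨a, Perfection.ext fun n => ?_⟩
  change PreTilt.coeff n x = PreTilt.coeff n (epsPow a)
  rw [coeff_epsPow, ha_val, ← hk_eq n, hu_coeff n]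

/-- If `(x♯)^{p^N} = 1` then `x^{p^N} = ε^a` for some `a ∈ ℤ_p`. [cite: FontaineAsterisque223III, Exp. II §1.2.2–1.2.3] -/
theorem PreTilt.exists_pow_eq_epsPow_of_untilt_pow_eq_one (x : PreTilt (integerC F) p) (N : ℕ)
    (hx : PreTilt.untilt x ^ p ^ N = 1) : ∃ a : ℤ_[p], x ^ p ^ N = epsPow a :=
  PreTilt.exists_eq_epsPow_of_untilt_eq_one (x ^ p ^ N) (by rw [map_pow, hx])

/-- If `x♯ = y♯` with `y` a unit of `𝒪_{ℂ_F}♭` then `x = ε^a · y` for some `a ∈ ℤ_p`. [cite: FontaineAsterisque223III, Exp. II §1.2.2–1.2.3] -/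
theorem PreTilt.exists_eq_epsPow_mul_of_untilt_eq (x : PreTilt (integerC F) p) (y : (PreTilt (integerC F) p)ˣ)
    (h : PreTilt.untilt x = PreTilt.untilt (y : PreTilt (integerC F) p)) :
    ∃ a : ℤ_[p], x = epsPow a * (y : PreTilt (integerC F) p) := by
  have h1 : PreTilt.untilt (x * ((y⁻¹ : (PreTilt (integerC F) p)ˣ) : PreTilt (integerC F) p)) = 1 := by
    have hy : PreTilt.untilt (y : PreTilt (integerC F) p) * PreTilt.untilt ((y⁻¹ : (PreTilt (integerC F) p)ˣ) : PreTilt (integerC F) p) = 1 := by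
      rw [← map_mul, Units.mul_inv, map_one]
    rw [map_mul, h, hy]
  obtain ⟨a, ha⟩ := PreTilt.exists_eq_epsPow_of_untilt_eq_one _ h1
  exact ⟨a, by rw [← ha, Units.inv_mul_cancel_right]⟩

end Literature.NumberTheory.PAdicHodge

end
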